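import Mathlib.Analysis.InnerProductSpace.Adjoint
import Mathlib.Analysis.Convolution
import Mathlib.MeasureTheory.Function.L2Space
import Literature.NumberTheory.ConnesConsani2021.SemilocalTwist
import Literature.NumberTheory.ConnesConsani2021.SoninProjection
import Literature.Analysis.OperatorTheory.HilbertSchmidtPartialSums
import HarnessLib

/-!
# Connes–Consani 2021: the scaling representation `ϑ` and the integrated operator `ϑ(f)` on `L²(ℝ)`;
# the Sonin trace form of `f = g ∗ g*` is the norm square `‖ϑ(g)* ξ‖²` (proof-layer infrastructure
# for Thm. 4.7 in the weak-trace typing)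

A. Connes, C. Consani, *Weil positivity and trace formula, the archimedean place*, Selecta Math. (N.S.)
27 (2021) 77 = arXiv:2006.13771 [bib: `ConnesConsani2021`].  Printed objects (§4 eq. (40) p. 15; proof
of Prop. 2.2 (iii) p. 10; "How the trace is typed" in `ArchimedeanSoninTrace.lean`):
"`(ϑ(λ)ξ)(v) := λ^{-1/2} ξ(λ^{-1}v)`, `ξ ∈ L²(ℝ)_ev`" — "the unitary representation `ϑ`" of `ℝ₊*` — and
"`ϑ(f) = ∫ f(ρ⁻¹)ϑ(ρ⁻¹)d*ρ`" `= ∫ f(λ)ϑ(λ)d*λ` for `f ∈ C_c^∞(ℝ₊*)`, so that (Prop. 2.2 (iii)/(iv),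
Cor. 2.3 (i)) `f ↦ Tr(ϑ(f)·)` is a functional on the CONVOLUTION ALGEBRA `C_c^∞(ℝ₊*)`, positive on
`f = g ∗ g*` "as the trace of a product of two positive operators" (proof of Cor. 2.3 (i), p. 11).

The statement layer (`ArchimedeanSoninTrace.lean`) deliberately typed only the MATRIX COEFFICIENTS
`scalingCoeff ξ η τ = ⟨ξ | ϑ(e^τ) η⟩` and the diagonal form `soninTraceForm k ξ = ∫ k(τ)⟨ξ | ϑ(e^τ)ξ⟩dτ`
("Mathlib has no … Bochner-integrated representation `ϑ(f)`; we do not build them"), and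
`SemilocalTwist.lean` identified `scalingCoeff` with an inner product against the tree's `L²` dilation
(`scalingCoeff_eq_inner`).  For the DISCHARGE of Theorem 4.7 in that typing (hypothesis `hTr` of
`MainInequalityAssembly.weilArchPositivity_soninTrace_fine_of_spectralData`: partial sums
`Σ_i Re⟨ξ_i | ϑ(g ∗ g*) ξ_i⟩` over orthonormal families of Sonin's space) one needs the operators
themselves.  This file builds them from the tree's `lpDilation` and Mathlib's Bochner integral, with
0 named facts (cell `rh-crit`, sub-cell `cc`, overflow row O4a, helper for node CC21:Thm27):

* `scalingUnitary τ` — `ϑ(e^τ) = e^{-τ/2} D_{e^{-τ}}` as a bounded operator on `L²(ℝ)` (**definition**);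
  `scalingCoeff_eq_inner_scalingUnitary` (`⟨ξ | ϑ(e^τ) η⟩ = ⟪ξ, scalingUnitary τ η⟫`: the statement
  layer's coefficient IS the matrix coefficient of this operator), `norm_scalingUnitary_apply` (isometry),
  `scalingUnitary_zero`, `scalingUnitary_add` (representation of `(ℝ, +) ≅ ℝ₊*`),
  `inner_scalingUnitary_left` / `adjoint_scalingUnitary` (`ϑ(λ)* = ϑ(λ⁻¹)`: unitary),
  `continuous_scalingUnitary_apply` (strongly continuous);
* `scalingOp g` — `ϑ(f) = ∫ g(τ) ϑ(e^τ) dτ`, `g = f ∘ exp ∈ L¹(ℝ)` the additive avatar, as a bounded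
  operator (Bochner integral of `τ ↦ g(τ) ϑ(e^τ) η`; **definition**, value `0` off `L¹`);
  `norm_scalingOp_apply_le` (`‖ϑ(f)η‖ ≤ ‖g‖₁‖η‖`), `inner_scalingOp`
  (`⟪ξ, ϑ(f) η⟫ = ∫ g(τ)⟨ξ | ϑ(e^τ) η⟩dτ`) and `soninTraceForm_eq_inner_scalingOp` — **the statement
  layer's `soninTraceForm k ξ` is literally `⟪ξ, ϑ(f) ξ⟫`**;
* `adjoint_scalingOp` — `ϑ(f)* = ϑ(f*)` (`f*(u) = conj f(u⁻¹)`, additive `weilReflect`), and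
  `scalingOp_weilConv` — `ϑ(g ∗ h) = ϑ(g) ϑ(h)` (`ϑ` is a representation of the convolution algebra;
  Fubini);
* `soninTraceForm_autocorr_eq_norm_sq` — **`⟨ξ | ϑ(g ∗ g*) ξ⟩ = ‖ϑ(g)* ξ‖²`**, hence
  `re_soninTraceForm_autocorr_nonneg` (each term of the weak trace is `≥ 0`: `ϑ(g ∗ g*) = ϑ(g)ϑ(g)*`
  is a positive operator — the positivity invoked in the proof of Cor. 2.3 (i)) and
  `sum_re_soninTraceForm_eq` (the left side of `hTr` is `Σ_i ‖ϑ(g)* ξ_i‖²`);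
* `sum_re_soninTraceForm_le_of_decomposition` — the bridge to
  `Literature/Analysis/OperatorTheory/HilbertSchmidtPartialSums.lean`: given the Hilbert–Schmidt value
  `L = Σ_k ‖C ϑ(g) e_k‖²` of "`Tr(ϑ(f) P P̂ P)`" (`Q = C* C`, §2) and `A = Σ_n μ_n ⟨χ_n | ϑ(f) χ_n⟩`
  for a decomposition `Q = Σ_n μ_n |χ_n⟩⟨χ_n| + 𝐒` as quadratic forms (§4 eq. (spectral)), every finite
  orthonormal family `(ξ_i)` of `S(1,1)` has `Σ_i Re⟨ξ_i | ϑ(g ∗ g*) ξ_i⟩ ≤ L − A` — the shape of `hTr`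
  with `L − A` in place of `W_∞(f) + E(f)`, i.e. Theorem 4.7's weak form REDUCED to the two printed
  trace computations (Prop. 2.2 (iii): `Tr(ϑ(f) P P̂ P) = W_∞(f) + ∫ f(ρ⁻¹)δ(ρ)d*ρ`; §4:
  `Σ λ(n)²⟨χ_n|ϑ(f)χ_n⟩ = ∫ f(ρ⁻¹)(δ − ε)(ρ)d*ρ`), with NO trace-class theory;
* `sum_re_soninTraceForm_le_of_hasSum_hilbertBasis` — STRONG ⇒ WEAK: if `Σ_j Re⟨b_j | ϑ(g ∗ g*) b_j⟩ = M`
  along one Hilbert basis of `S(1,1)` then every finite orthonormal partial sum is `≤ M` (the `hTr` form),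
  and `hasSum_re_soninTraceForm_hilbertBasis_of_hasSum` — that sum does not depend on the basis.

Label: RH-FREE operator bookkeeping at the archimedean place; nothing here is an inequality with
arithmetic content, nothing bears on RH.  Net debt delta 0 (two definitions with bodies, theorems).

## References

* A. Connes, C. Consani, Selecta Math. (N.S.) 27 (2021) 77 = arXiv:2006.13771: §4 eq. (40) (p. 15,
  arXiv chunk p0015), Prop. 2.2 (iii) and its proof (p. 10, chunk p0010), Cor. 2.3 (i) and its proof
  (p. 11, chunk p0011), Thm. 4.7 and its proof (p. 18, chunk p0018). [ConnesConsani2021]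
* M. Reed, B. Simon, *Methods of Modern Mathematical Physics I* (1972), Thm. VI.18, VI.22 (PDF pp. 196,
  198 of the held copy) — Hilbert–Schmidt sums in place of the trace. [ReedSimon1972]
-/

noncomputable section

open _root_.MeasureTheory Complex Set Filter
open scoped Real ComplexConjugate ENNReal InnerProductSpace Topology

namespace Literature.NumberTheory.ConnesConsani2021

open Literature.NumberTheory.LFunctions Literature.Analysis.OperatorTheory

/-! ## `ϑ(e^τ)` as a bounded operator on `L²(ℝ)` -/

/-- Changing the scale parameter of `lpDilation` along an equality of reals (proof irrelevance;
plumbing). [folklore] -/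
private theorem lpDilation_congr {a b : ℝ} (h : a = b) (ha : a ≠ 0) (hb : b ≠ 0) :
    (lpDilation (V := ℝ) (F := ℂ) (p := (2 : ℝ≥0∞)) a ha ENNReal.ofNat_ne_top :
        Lp ℂ 2 (volume : Measure ℝ) →L[ℂ] Lp ℂ 2 (volume : Measure ℝ)) =
      lpDilation (V := ℝ) (F := ℂ) (p := (2 : ℝ≥0∞)) b hb ENNReal.ofNat_ne_top := by
  subst h
  rfl

/-- **CC's scaling representation at `λ = e^τ` as a bounded operator on `L²(ℝ)`**:
`(ϑ(λ)ξ)(v) := λ^{-1/2} ξ(λ^{-1} v)` (§4 eq. (40), p. 15), i.e. `ϑ(e^τ) = e^{-τ/2} · D_{e^{-τ}}` with the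
tree's `L²` dilation `D_a ξ = ξ(a ·)` (`Literature.Analysis.OperatorTheory.lpDilation`).  CC let `ϑ` act on
`L²(ℝ)_ev`; the same formula acts on all of `L²(ℝ)` and preserves even functions.
[cite: ConnesConsani2021, §4 eq. (40) p. 15] -/
def scalingUnitary (τ : ℝ) : Lp ℂ 2 (volume : Measure ℝ) →L[ℂ] Lp ℂ 2 (volume : Measure ℝ) :=
  (Real.exp (-τ / 2) : ℂ) •
    lpDilation (V := ℝ) (F := ℂ) (p := (2 : ℝ≥0∞)) (Real.exp (-τ)) (Real.exp_pos _).ne'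
      ENNReal.ofNat_ne_top

/-- Unfolding `scalingUnitary`. [cite: ConnesConsani2021, §4 eq. (40) p. 15] -/
theorem scalingUnitary_apply (τ : ℝ) (η : Lp ℂ 2 (volume : Measure ℝ)) :
    scalingUnitary τ η = (Real.exp (-τ / 2) : ℂ) •
      lpDilation (V := ℝ) (F := ℂ) (p := (2 : ℝ≥0∞)) (Real.exp (-τ)) (Real.exp_pos _).ne'
        ENNReal.ofNat_ne_top η :=
  rfl

/-- `(ϑ(e^τ)η)(v) = e^{-τ/2} η(e^{-τ} v)` almost everywhere (the printed formula (40) with `λ = e^τ`).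
[cite: ConnesConsani2021, §4 eq. (40) p. 15] -/
theorem scalingUnitary_coeFn (τ : ℝ) (η : Lp ℂ 2 (volume : Measure ℝ)) :
    (scalingUnitary τ η : ℝ → ℂ) =ᵐ[volume]
      fun v => (Real.exp (-τ / 2) : ℂ) * (η : ℝ → ℂ) (Real.exp (-τ) * v) := by
  rw [scalingUnitary_apply]
  filter_upwards [Lp.coeFn_smul (Real.exp (-τ / 2) : ℂ)
      (lpDilation (V := ℝ) (F := ℂ) (p := (2 : ℝ≥0∞)) (Real.exp (-τ)) (Real.exp_pos _).ne'
        ENNReal.ofNat_ne_top η),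
    lpDilation_coeFn (V := ℝ) (F := ℂ) (p := (2 : ℝ≥0∞)) (Real.exp_pos (-τ)).ne'
      ENNReal.ofNat_ne_top η] with v h1 h2
  rw [h1, Pi.smul_apply, h2, smul_eq_mul, smul_eq_mul]

/-- **The statement layer's matrix coefficient is the matrix coefficient of `scalingUnitary`**:
`⟨ξ | ϑ(e^τ) η⟩ = ⟪ξ, scalingUnitary τ η⟫_{L²(ℝ)}` (`scalingCoeff` of `ArchimedeanSoninTrace.lean`;
via `scalingCoeff_eq_inner`). [cite: ConnesConsani2021, §4 eq. (40) p. 15] -/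
theorem scalingCoeff_eq_inner_scalingUnitary (ξ η : Lp ℂ 2 (volume : Measure ℝ)) (τ : ℝ) :
    scalingCoeff ξ η τ = ⟪ξ, scalingUnitary τ η⟫_ℂ := by
  rw [scalingCoeff_eq_inner, scalingUnitary_apply, inner_smul_right]

/-- **`ϑ(e^τ)` is an isometry of `L²(ℝ)`**: `‖ϑ(e^τ)η‖ = ‖η‖` ("the unitary representation `ϑ`";
the factor `λ^{-1/2}` exactly compensates the `L²` scaling law `‖η(e^{-τ}·)‖ = e^{τ/2}‖η‖`).
[cite: ConnesConsani2021, §4 eq. (40) p. 15] -/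
theorem norm_scalingUnitary_apply (τ : ℝ) (η : Lp ℂ 2 (volume : Measure ℝ)) :
    ‖scalingUnitary τ η‖ = ‖η‖ := by
  rw [scalingUnitary_apply, norm_smul, norm_lpDilation_exp, Complex.norm_real, Real.norm_eq_abs,
    abs_of_pos (Real.exp_pos _), ← mul_assoc, ← Real.exp_add, show -τ / 2 + τ / 2 = 0 by ring,
    Real.exp_zero, one_mul]

/-- `ϑ(1) = 1`. [cite: ConnesConsani2021, §4 eq. (40) p. 15] -/
theorem scalingUnitary_zero : scalingUnitary 0 = 1 := by
  unfold scalingUnitary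
  rw [lpDilation_congr (show Real.exp (-(0 : ℝ)) = 1 by simp) _ one_ne_zero,
    lpDilation_one, show -(0 : ℝ) / 2 = 0 by ring, Real.exp_zero, Complex.ofReal_one, one_smul]

/-- **`ϑ` is a representation**: `ϑ(e^{σ+τ}) = ϑ(e^σ) ϑ(e^τ)` (`D_a D_b = D_{ba}` and
`e^{-σ/2}e^{-τ/2} = e^{-(σ+τ)/2}`). [cite: ConnesConsani2021, §4 eq. (40) p. 15] -/
theorem scalingUnitary_add (σ τ : ℝ) :
    scalingUnitary (σ + τ) = scalingUnitary σ ∘L scalingUnitary τ := by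
  unfold scalingUnitary
  rw [ContinuousLinearMap.smul_comp, ContinuousLinearMap.comp_smul, smul_smul,
    ← ContinuousLinearMap.mul_def, lpDilation_mul,
    lpDilation_congr (show Real.exp (-τ) * Real.exp (-σ) = Real.exp (-(σ + τ)) by
      rw [← Real.exp_add]; ring_nf) _ (Real.exp_pos _).ne']
  congr 1
  rw [← Complex.ofReal_mul, ← Real.exp_add]
  congr 2
  ring

/-- **Unitarity in inner-product form**: `⟪ϑ(e^τ)ξ, ζ⟫ = ⟪ξ, ϑ(e^{-τ})ζ⟫` (substitute `v = e^{τ}w`;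
the tree's `inner_lpDilation_left`). [cite: ConnesConsani2021, §4 eq. (40) p. 15] -/
theorem inner_scalingUnitary_left (τ : ℝ) (ξ ζ : Lp ℂ 2 (volume : Measure ℝ)) :
    ⟪scalingUnitary τ ξ, ζ⟫_ℂ = ⟪ξ, scalingUnitary (-τ) ζ⟫_ℂ := by
  rw [scalingUnitary_apply, scalingUnitary_apply, inner_smul_left, inner_smul_right,
    inner_lpDilation_left,
    lpDilation_congr (show (Real.exp (-τ))⁻¹ = Real.exp (-(-τ)) by
      rw [neg_neg, Real.exp_neg, inv_inv]) _ (Real.exp_pos _).ne',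
    Complex.conj_ofReal, ← mul_assoc, ← Complex.ofReal_mul, abs_of_pos (Real.exp_pos _),
    ← Real.exp_neg, ← Real.exp_add]
  congr 3
  ring

/-- **`ϑ(λ)* = ϑ(λ⁻¹)`**: the adjoint of `scalingUnitary τ` is `scalingUnitary (−τ)` (unitarity of `ϑ`).
[cite: ConnesConsani2021, §4 eq. (40) p. 15] -/
theorem adjoint_scalingUnitary (τ : ℝ) :
    ContinuousLinearMap.adjoint (scalingUnitary τ) = scalingUnitary (-τ) := by
  symm
  rw [ContinuousLinearMap.eq_adjoint_iff]
  intro ξ ζ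
  rw [inner_scalingUnitary_left, neg_neg]

/-- **Strong continuity**: `τ ↦ ϑ(e^τ)η` is continuous in `L²(ℝ)` for every `η` (strong continuity of
dilations, `continuous_lpDilation_apply`). [cite: ConnesConsani2021, §4 eq. (40) p. 15] -/
theorem continuous_scalingUnitary_apply (η : Lp ℂ 2 (volume : Measure ℝ)) :
    Continuous fun τ : ℝ => scalingUnitary τ η := by
  have h1 : Continuous fun τ : ℝ => (Real.exp (-τ / 2) : ℂ) := by fun_prop
  have h2 : Continuous fun τ : ℝ =>
      lpDilation (V := ℝ) (F := ℂ) (p := (2 : ℝ≥0∞)) (Real.exp (-τ)) (Real.exp_pos (-τ)).ne'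
        ENNReal.ofNat_ne_top η :=
    continuous_lpDilation_apply (V := ℝ) (F := ℂ) ENNReal.ofNat_ne_top η
      (a := fun τ : ℝ => Real.exp (-τ)) (by fun_prop) fun τ => (Real.exp_pos (-τ)).ne'
  exact h1.smul h2

/-! ## The integrated operator `ϑ(f) = ∫ g(τ) ϑ(e^τ) dτ` -/

section Integrated

variable {g h : ℝ → ℂ}

/-- The Bochner integrand `τ ↦ g(τ) ϑ(e^τ) η` has norm `|g(τ)| ‖η‖`. [cite: ConnesConsani2021, §4 eq. (40) p. 15] -/
theorem norm_smul_scalingUnitary_apply (g : ℝ → ℂ) (τ : ℝ) (η : Lp ℂ 2 (volume : Measure ℝ)) :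
    ‖g τ • scalingUnitary τ η‖ = ‖g τ‖ * ‖η‖ := by
  rw [norm_smul, norm_scalingUnitary_apply]

/-- For `g ∈ L¹` the integrand `τ ↦ g(τ) ϑ(e^τ) η` is Bochner integrable in `L²(ℝ)` (it is strongly
measurable — `g` measurable, `τ ↦ ϑ(e^τ)η` continuous — with norm `|g| ‖η‖ ∈ L¹`).
[cite: ConnesConsani2021, Prop. 2.2 (iii) p. 10 (proof: `ϑ(f) = ∫ f(λ)ϑ(λ)d*λ`)] -/
theorem integrable_smul_scalingUnitary (hg : Integrable g) (η : Lp ℂ 2 (volume : Measure ℝ)) :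
    Integrable fun τ : ℝ => g τ • scalingUnitary τ η :=
  (hg.norm.mul_const ‖η‖).mono'
    (hg.aestronglyMeasurable.smul (continuous_scalingUnitary_apply η).aestronglyMeasurable)
    (Eventually.of_forall fun τ => (norm_smul_scalingUnitary_apply g τ η).le)

/-- The underlying linear map of `ϑ(f)` for `g = f ∘ exp ∈ L¹`. [cite: ConnesConsani2021, Prop. 2.2 (iii) p. 10 (proof)] -/
private def scalingOpLin (hg : Integrable g) :
    Lp ℂ 2 (volume : Measure ℝ) →ₗ[ℂ] Lp ℂ 2 (volume : Measure ℝ) where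
  toFun η := ∫ τ, g τ • scalingUnitary τ η
  map_add' η η' := by
    simp only [map_add, smul_add]
    exact integral_add (integrable_smul_scalingUnitary hg η) (integrable_smul_scalingUnitary hg η')
  map_smul' c η := by
    simp only [map_smul, RingHom.id_apply]
    rw [← integral_smul]
    exact integral_congr_ae (Eventually.of_forall fun τ => smul_comm _ _ _)

/-- **CC's integrated operator `ϑ(f) := ∫ f(λ) ϑ(λ) d*λ`** (proof of Prop. 2.2 (iii), p. 10), for the
additive avatar `g = f ∘ exp`: `ϑ(f) η = ∫_ℝ g(τ) ϑ(e^τ) η dτ` (Bochner integral in `L²(ℝ)`), a bounded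
operator with `‖ϑ(f)‖ ≤ ‖g‖_{L¹}`.  Defined for every `g : ℝ → ℂ`; it is the printed operator for
`g ∈ L¹(ℝ)` (in particular for `g ∈ C_c^∞`) and is set to `0` otherwise.
[cite: ConnesConsani2021, Prop. 2.2 (iii) p. 10 (proof)] -/
def scalingOp (g : ℝ → ℂ) : Lp ℂ 2 (volume : Measure ℝ) →L[ℂ] Lp ℂ 2 (volume : Measure ℝ) := by
  classical
  exact if hg : Integrable g then
    (scalingOpLin hg).mkContinuous (∫ τ, ‖g τ‖) fun η => by
      change ‖∫ τ, g τ • scalingUnitary τ η‖ ≤ (∫ τ, ‖g τ‖) * ‖η‖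
      calc ‖∫ τ, g τ • scalingUnitary τ η‖ ≤ ∫ τ, ‖g τ • scalingUnitary τ η‖ :=
            norm_integral_le_integral_norm _
        _ = ∫ τ, ‖g τ‖ * ‖η‖ := by simp_rw [norm_smul_scalingUnitary_apply]
        _ = (∫ τ, ‖g τ‖) * ‖η‖ := integral_mul_const _ _
  else 0

/-- `ϑ(f) η = ∫ g(τ) ϑ(e^τ) η dτ` for `g ∈ L¹`. [cite: ConnesConsani2021, Prop. 2.2 (iii) p. 10 (proof)] -/
theorem scalingOp_apply (hg : Integrable g) (η : Lp ℂ 2 (volume : Measure ℝ)) :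
    scalingOp g η = ∫ τ, g τ • scalingUnitary τ η := by
  rw [scalingOp, dif_pos hg]
  rfl

/-- **`‖ϑ(f) η‖ ≤ ‖g‖_{L¹} ‖η‖`** (`‖∫ g ϑ η‖ ≤ ∫ |g| ‖ϑη‖`, `ϑ` isometric).
[cite: ConnesConsani2021, Prop. 2.2 (iii) p. 10 (proof)] -/
theorem norm_scalingOp_apply_le (hg : Integrable g) (η : Lp ℂ 2 (volume : Measure ℝ)) :
    ‖scalingOp g η‖ ≤ (∫ τ, ‖g τ‖) * ‖η‖ := by
  rw [scalingOp_apply hg]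
  calc ‖∫ τ, g τ • scalingUnitary τ η‖ ≤ ∫ τ, ‖g τ • scalingUnitary τ η‖ :=
        norm_integral_le_integral_norm _
    _ = ∫ τ, ‖g τ‖ * ‖η‖ := by simp_rw [norm_smul_scalingUnitary_apply]
    _ = (∫ τ, ‖g τ‖) * ‖η‖ := integral_mul_const _ _

/-- **`⟪ξ, ϑ(f) η⟫ = ∫ g(τ) ⟨ξ | ϑ(e^τ) η⟩ dτ`** — the printed "`⟨ξ | ϑ(f) ξ⟩ = ∫ f(λ)⟨ξ|ϑ(λ)ξ⟩d*λ`"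
(inner product through the Bochner integral, `integral_inner`).
[cite: ConnesConsani2021, Prop. 2.2 (iii) p. 10 (proof)] -/
theorem inner_scalingOp (hg : Integrable g) (ξ η : Lp ℂ 2 (volume : Measure ℝ)) :
    ⟪ξ, scalingOp g η⟫_ℂ = ∫ τ, g τ * scalingCoeff ξ η τ := by
  rw [scalingOp_apply hg, ← integral_inner (integrable_smul_scalingUnitary hg η)]
  refine integral_congr_ae (Eventually.of_forall fun τ => ?_)
  change ⟪ξ, g τ • scalingUnitary τ η⟫_ℂ = g τ * scalingCoeff ξ η τ
  rw [inner_smul_right, scalingCoeff_eq_inner_scalingUnitary]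

/-- **The statement layer's Sonin trace form is a diagonal matrix coefficient of `ϑ(f)`**:
`soninTraceForm k ξ = ⟪ξ, ϑ(f) ξ⟫` for `k = f ∘ exp ∈ L¹` (`ArchimedeanSoninTrace.lean`, "How the trace
is typed": `⟨ξ | ϑ(f) ξ⟩ = ∫ k(τ)⟨ξ | ϑ(e^τ) ξ⟩ dτ`). [cite: ConnesConsani2021, Prop. 2.2 (iii) p. 10 (proof)] -/
theorem soninTraceForm_eq_inner_scalingOp {k : ℝ → ℂ} (hk : Integrable k)
    (ξ : Lp ℂ 2 (volume : Measure ℝ)) :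
    soninTraceForm k ξ = ⟪ξ, scalingOp k ξ⟫_ℂ := by
  rw [inner_scalingOp hk]
  rfl

/-! ## `ϑ` as a `*`-representation of the convolution algebra: `ϑ(f)* = ϑ(f*)`, `ϑ(g ∗ h) = ϑ(g)ϑ(h)` -/

/-- The involution preserves integrability. [folklore] -/
private theorem integrable_weilReflect' (hg : Integrable g) : Integrable (weilReflect g) := by
  have hneg : Integrable fun t : ℝ => g (-t) := hg.comp_neg
  refine hneg.norm.mono'
    (Complex.continuous_conj.comp_aestronglyMeasurable hneg.aestronglyMeasurable)
    (Eventually.of_forall fun t => ?_)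
  simp [weilReflect]

/-- **`ϑ(f)* = ϑ(f*)`**: the adjoint of `scalingOp g` is `scalingOp (weilReflect g)`, `g*(t) = conj g(−t)`
(App. A eq. (77): `f*(u) = conj f(u⁻¹)`; with `ϑ(λ)* = ϑ(λ⁻¹)` this is the compatibility of `ϑ` with the
involution, used in "`Tr(ϑ(g)𝐒ϑ(g)*)`", Thm. 1 / Thm. 6.11).  Proof:
`⟪ϑ(g*)ξ, η⟫ = conj ∫ g*(τ)⟨η|ϑ(e^τ)ξ⟩ = ∫ g(−τ)⟨ξ|ϑ(e^{−τ})η⟩ = ⟪ξ, ϑ(g)η⟫`.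
[cite: ConnesConsani2021, App. A eq. (77) p. 30; §4 eq. (40) p. 15] -/
theorem adjoint_scalingOp (hg : Integrable g) :
    ContinuousLinearMap.adjoint (scalingOp g) = scalingOp (weilReflect g) := by
  symm
  rw [ContinuousLinearMap.eq_adjoint_iff]
  intro ξ η
  rw [← inner_conj_symm, inner_scalingOp (integrable_weilReflect' hg), inner_scalingOp hg,
    ← integral_conj]
  have h : ∀ τ : ℝ, conj (weilReflect g τ * scalingCoeff η ξ τ) = g (-τ) * scalingCoeff ξ η (-τ) := by
    intro τ
    rw [map_mul, weilReflect, Complex.conj_conj, scalingCoeff_eq_inner_scalingUnitary,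
      scalingCoeff_eq_inner_scalingUnitary, inner_conj_symm, inner_scalingUnitary_left]
  simp_rw [h]
  exact integral_neg_eq_self (fun τ : ℝ => g τ * scalingCoeff ξ η τ) volume

/-- `⟨ξ | ϑ(e^σ) ϑ(h) η⟩ = ∫ h(τ) ⟨ξ | ϑ(e^{σ+τ}) η⟩ dτ` (move `ϑ(e^σ)` to the left as `ϑ(e^{−σ})`,
expand `ϑ(h)`, and use `ϑ(e^σ)ϑ(e^τ) = ϑ(e^{σ+τ})`).
[cite: ConnesConsani2021, §4 eq. (40) p. 15; Prop. 2.2 (iii) p. 10 (proof)] -/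
theorem scalingCoeff_scalingOp (hh : Integrable h) (ξ η : Lp ℂ 2 (volume : Measure ℝ)) (σ : ℝ) :
    scalingCoeff ξ (scalingOp h η) σ = ∫ τ, h τ * scalingCoeff ξ η (σ + τ) := by
  have h1 : scalingCoeff ξ (scalingOp h η) σ = ⟪scalingUnitary (-σ) ξ, scalingOp h η⟫_ℂ := by
    rw [scalingCoeff_eq_inner_scalingUnitary, inner_scalingUnitary_left, neg_neg]
  rw [h1, inner_scalingOp hh]
  refine integral_congr_ae (Eventually.of_forall fun τ => ?_)
  change h τ * scalingCoeff (scalingUnitary (-σ) ξ) η τ = h τ * scalingCoeff ξ η (σ + τ)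
  rw [scalingCoeff_eq_inner_scalingUnitary, scalingCoeff_eq_inner_scalingUnitary,
    inner_scalingUnitary_left, neg_neg, scalingUnitary_add, ContinuousLinearMap.comp_apply]

/-- **`ϑ(g ∗ h) = ϑ(g) ϑ(h)`** for `g, h ∈ L¹(ℝ)`: `ϑ` is a representation of the convolution algebra
(`(g ∗ h)(u) = ∫ g(σ) h(u − σ) dσ` is multiplicative convolution on `ℝ₊*`, App. A eq. (77); this is what
makes `f ↦ Tr(ϑ(f)·)` a functional "on the convolution algebra `C_c^∞(ℝ₊*)`", Cor. 2.3 (i), and gives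
`ϑ(g ∗ g*) = ϑ(g)ϑ(g)*`).  Proof: compare matrix coefficients; Fubini for
`(u, σ) ↦ g(σ) h(u − σ) ⟨ξ | ϑ(e^u) η⟩` (integrable: `L¹ ∗ L¹` integrand times a bounded continuous
coefficient) and the substitution `u = σ + τ`.
[cite: ConnesConsani2021, App. A eq. (77) p. 30; Cor. 2.3 (i) p. 11] -/
theorem scalingOp_weilConv (hg : Integrable g) (hh : Integrable h) :
    scalingOp (weilConv g h) = scalingOp g ∘L scalingOp h := by
  have hgh : Integrable (weilConv g h) := hg.integrable_convolution (ContinuousLinearMap.mul ℂ ℂ) hh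
  refine ContinuousLinearMap.ext fun η => ext_inner_left ℂ fun ξ => ?_
  rw [ContinuousLinearMap.comp_apply, inner_scalingOp hgh, inner_scalingOp hg]
  simp_rw [scalingCoeff_scalingOp hh]
  have hc_cont : Continuous fun u : ℝ => scalingCoeff ξ η u := continuous_scalingCoeff ξ η
  have hc_bdd : ∀ u : ℝ, ‖scalingCoeff ξ η u‖ ≤ ‖ξ‖ * ‖η‖ := norm_scalingCoeff_le ξ η
  -- the integrand on `ℝ × ℝ`, `(u, σ) ↦ g(σ) h(u − σ) ⟨ξ|ϑ(e^u)η⟩`, is integrable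
  have hF : Integrable (fun p : ℝ × ℝ => g p.2 * h (p.1 - p.2) * scalingCoeff ξ η p.1)
      ((volume : Measure ℝ).prod volume) := by
    have h1 := hg.convolution_integrand (ContinuousLinearMap.mul ℂ ℂ) (μ := volume) (ν := volume) hh
    simp only [ContinuousLinearMap.mul_apply'] at h1
    exact h1.mul_bdd (hc_cont.comp continuous_fst).aestronglyMeasurable
      (Eventually.of_forall fun p => hc_bdd p.1)
  calc ∫ u, weilConv g h u * scalingCoeff ξ η u
      = ∫ u, ∫ σ, g σ * h (u - σ) * scalingCoeff ξ η u := by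
        refine integral_congr_ae (Eventually.of_forall fun u => ?_)
        change weilConv g h u * scalingCoeff ξ η u = ∫ σ, g σ * h (u - σ) * scalingCoeff ξ η u
        rw [weilConv_apply, ← integral_mul_const]
    _ = ∫ σ, ∫ u, g σ * h (u - σ) * scalingCoeff ξ η u := integral_integral_swap hF
    _ = ∫ σ, g σ * ∫ τ, h τ * scalingCoeff ξ η (σ + τ) := by
        refine integral_congr_ae (Eventually.of_forall fun σ => ?_)
        change ∫ u, g σ * h (u - σ) * scalingCoeff ξ η u = g σ * ∫ τ, h τ * scalingCoeff ξ η (σ + τ)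
        simp_rw [mul_assoc]
        rw [integral_const_mul, ← integral_sub_right_eq_self
          (fun τ : ℝ => h τ * scalingCoeff ξ η (σ + τ)) σ]
        congr 1
        refine integral_congr_ae (Eventually.of_forall fun u => ?_)
        simp only [add_sub_cancel]

/-! ## The Sonin trace form of `g ∗ g*` is a norm square -/

/-- **`⟨ξ | ϑ(g ∗ g*) ξ⟩ = ‖ϑ(g*) ξ‖² = ‖ϑ(g)* ξ‖²`** for `g ∈ L¹(ℝ)` and `ξ ∈ L²(ℝ)`: the statement
layer's `soninTraceForm (g ∗ g*) ξ` is the norm square of `ϑ(g)* ξ` — the identity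
"`Tr(ϑ(g) 𝐒 ϑ(g)*) = … = Σ_e ⟨e | ϑ(f) e⟩`, each term is `‖𝐒 ϑ(g)* ξ_i‖² ≥ 0`" of "How the trace is
typed" (`ArchimedeanSoninTrace.lean`), made literal: `ϑ(g ∗ g*) = ϑ(g)ϑ(g*) = ϑ(g)ϑ(g)*`.
[cite: ConnesConsani2021, Cor. 2.3 (i) p. 11 (proof: "positive for `f = g ∗ g*` as the trace of a product of two positive operators"); Thm. 1 (Intro p. 4)] -/
theorem soninTraceForm_autocorr_eq_norm_sq (hg : Integrable g) (ξ : Lp ℂ 2 (volume : Measure ℝ)) :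
    soninTraceForm (weilConv g (weilReflect g)) ξ =
      (((‖scalingOp (weilReflect g) ξ‖ ^ 2 : ℝ)) : ℂ) := by
  have hg' : Integrable (weilReflect g) := integrable_weilReflect' hg
  have hA : scalingOp g = ContinuousLinearMap.adjoint (scalingOp (weilReflect g)) := by
    rw [← adjoint_scalingOp hg, ContinuousLinearMap.adjoint_adjoint]
  have hgg : Integrable (weilConv g (weilReflect g)) :=
    hg.integrable_convolution (ContinuousLinearMap.mul ℂ ℂ) hg'
  rw [soninTraceForm_eq_inner_scalingOp hgg, scalingOp_weilConv hg hg',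
    ContinuousLinearMap.comp_apply, hA,
    ContinuousLinearMap.adjoint_inner_right, inner_self_eq_norm_sq_to_K]
  norm_cast

/-- **Real form**: `Re⟨ξ | ϑ(g ∗ g*) ξ⟩ = ‖ϑ(g)* ξ‖²`. [cite: ConnesConsani2021, Cor. 2.3 (i) p. 11 (proof); Thm. 1 (Intro p. 4)] -/
theorem re_soninTraceForm_autocorr (hg : Integrable g) (ξ : Lp ℂ 2 (volume : Measure ℝ)) :
    (soninTraceForm (weilConv g (weilReflect g)) ξ).re =
      ‖ContinuousLinearMap.adjoint (scalingOp g) ξ‖ ^ 2 := by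
  rw [soninTraceForm_autocorr_eq_norm_sq hg, adjoint_scalingOp hg, Complex.ofReal_re]

/-- **Positivity of each weak-trace term**: `0 ≤ Re⟨ξ | ϑ(g ∗ g*) ξ⟩` (`ϑ(g ∗ g*) = ϑ(g)ϑ(g)*` is a
positive operator).  In particular the partial sums of the typed Sonin trace increase with the family.
[cite: ConnesConsani2021, Cor. 2.3 (i) p. 11 (proof)] -/
theorem re_soninTraceForm_autocorr_nonneg (hg : Integrable g) (ξ : Lp ℂ 2 (volume : Measure ℝ)) :
    0 ≤ (soninTraceForm (weilConv g (weilReflect g)) ξ).re := by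
  rw [re_soninTraceForm_autocorr hg]
  exact sq_nonneg _

/-- The imaginary part vanishes: `⟨ξ | ϑ(g ∗ g*) ξ⟩` is real. [cite: ConnesConsani2021, Cor. 2.3 (i) p. 11 (proof)] -/
theorem im_soninTraceForm_autocorr (hg : Integrable g) (ξ : Lp ℂ 2 (volume : Measure ℝ)) :
    (soninTraceForm (weilConv g (weilReflect g)) ξ).im = 0 := by
  rw [soninTraceForm_autocorr_eq_norm_sq hg, Complex.ofReal_im]

/-- **The left side of `hTr` / of Thm. 4.7's weak form is a partial Hilbert–Schmidt sum**: for a finite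
family `(ξ_i)`, `Σ_i Re⟨ξ_i | ϑ(g ∗ g*) ξ_i⟩ = Σ_i ‖ϑ(g)* ξ_i‖²`.
[cite: ConnesConsani2021, Thm. 4.7 §4 p. 18; Thm. 1 (Intro p. 4)] -/
theorem sum_re_soninTraceForm_autocorr_eq (hg : Integrable g) {ι : Type*} (s : Finset ι)
    (ξ : ι → Lp ℂ 2 (volume : Measure ℝ)) :
    ∑ i ∈ s, (soninTraceForm (weilConv g (weilReflect g)) (ξ i)).re =
      ∑ i ∈ s, ‖ContinuousLinearMap.adjoint (scalingOp g) (ξ i)‖ ^ 2 :=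
  Finset.sum_congr rfl fun i _ => re_soninTraceForm_autocorr hg (ξ i)

/-! ## Bridge to the Hilbert–Schmidt bookkeeping: Thm. 4.7's weak form reduced to two trace computations -/

/-- **Theorem 4.7 (weak form) reduced to the two printed trace computations, with no trace class.**
Let `g ∈ L¹(ℝ)` (e.g. a test function), `f = g ∗ g*`, `B = ϑ(g)`.  Suppose a bounded `Q` on `L²(ℝ)` is a
square, `Re⟨x | Q x⟩ = ‖C x‖²` (in the source `Q = P P̂ P`, `C = P̂ P`), and decomposes as quadratic forms
as `Re⟨x | Q x⟩ = Σ_n μ_n |⟨χ_n | x⟩|² + ‖𝐒 x‖²`, `μ_n ≥ 0`, `𝐒 = soninProjection 1 1` (Prop. 4.5 (iii)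
eq. (spectral): `P P̂ P = Σ λ(n)² |χ_n⟩⟨χ_n| + 𝐒`).  If the Hilbert–Schmidt sum `Σ_k ‖C ϑ(g) e_k‖²`
over some Hilbert basis `(e_k)` of `L²(ℝ)` converges to `L` ("`Tr(ϑ(f) P P̂ P)`", computed in
Prop. 2.2 (iii) as `W_∞(f) + ∫ f(ρ⁻¹)δ(ρ)d*ρ`) and `Σ_n μ_n Re⟨χ_n | ϑ(f) χ_n⟩` converges to `A` (computed
in §4 from (chirem1)/(hattrick) as `∫ f(ρ⁻¹)(δ − ε)(ρ) d*ρ`), then every finite orthonormal family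
`(ξ_i)` of Sonin's space `S(1,1)` satisfies `Σ_i Re⟨ξ_i | ϑ(f) ξ_i⟩ ≤ L − A` — the printed last step
"`Tr(ϑ(f) P P̂ P) = Tr(ϑ(f)𝐒) + Σ λ(n)²⟨χ_n|ϑ(f)χ_n⟩`" together with "partial sums `≤ Tr(ϑ(g)𝐒ϑ(g)*)`",
in the exact shape of `hTr` with `L − A` for `W_∞(f) + E(f)`.
[cite: ConnesConsani2021, Thm. 4.7 §4 p. 18 (proof, last step); Prop. 4.5 (iii) eq. (spectral)] -/
theorem sum_re_soninTraceForm_le_of_decomposition (hg : Integrable g) {ι' κ : Type*}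
    {G : Type*} [NormedAddCommGroup G] [InnerProductSpace ℂ G]
    {χ : ι' → Lp ℂ 2 (volume : Measure ℝ)} {μ : ι' → ℝ} (hμ : ∀ n, 0 ≤ μ n)
    {Q : Lp ℂ 2 (volume : Measure ℝ) →L[ℂ] Lp ℂ 2 (volume : Measure ℝ)}
    {C : Lp ℂ 2 (volume : Measure ℝ) →L[ℂ] G}
    (hC : ∀ x, (⟪x, Q x⟫_ℂ).re = ‖C x‖ ^ 2)
    (hQ : ∀ x, HasSum (fun n => μ n * ‖⟪χ n, x⟫_ℂ‖ ^ 2)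
      ((⟪x, Q x⟫_ℂ).re - ‖soninProjection 1 1 x‖ ^ 2))
    (e : HilbertBasis κ ℂ (Lp ℂ 2 (volume : Measure ℝ))) {L A : ℝ}
    (hL : HasSum (fun k => ‖C (scalingOp g (e k))‖ ^ 2) L)
    (hA : HasSum (fun n => μ n * (soninTraceForm (weilConv g (weilReflect g)) (χ n)).re) A)
    {n : ℕ} (ξ : Fin n → Lp ℂ 2 (volume : Measure ℝ)) (hξ : Orthonormal ℂ ξ)
    (hS : ∀ i, ξ i ∈ soninSpace 1 1) :
    ∑ i, (soninTraceForm (weilConv g (weilReflect g)) (ξ i)).re ≤ L - A := by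
  rw [sum_re_soninTraceForm_autocorr_eq hg]
  simp_rw [re_soninTraceForm_autocorr hg] at hA
  have hC' : ∀ x, RCLike.re ⟪x, Q x⟫_ℂ = ‖C x‖ ^ 2 := fun x => by
    rw [RCLike.re_to_complex, hC]
  have hQ' : ∀ x, HasSum (fun n => μ n * ‖⟪χ n, x⟫_ℂ‖ ^ 2)
      (RCLike.re ⟪x, Q x⟫_ℂ - ‖(soninSpace 1 1).starProjection x‖ ^ 2) := fun x => by
    rw [RCLike.re_to_complex]
    exact hQ x
  exact sum_norm_sq_adjoint_le_of_decomposition (V := soninSpace 1 1) hμ hC' hQ' (scalingOp g) e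
    hL hA hξ hS Finset.univ

/-- **Strong form ⇒ weak form** (the adapter from "`Tr(ϑ(f)𝐒) = M` along ONE orthonormal basis of
`S(1,1)`" to the `hTr` typing "every finite orthonormal partial sum is `≤ M`"): if for some Hilbert basis
`(b_j)` of Sonin's space `Σ_j Re⟨b_j | ϑ(g ∗ g*) b_j⟩ = M` converges, then for every finite orthonormal
family `(ξ_i)` in `S(1,1)`, `Σ_i Re⟨ξ_i | ϑ(g ∗ g*) ξ_i⟩ ≤ M` (each term is `‖ϑ(g)* ·‖²`; orthonormal
partial sums are bounded by the Hilbert–Schmidt sum, `sum_norm_sq_apply_le_of_hasSum`).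
[cite: ConnesConsani2021, Thm. 4.7 §4 p. 18; Thm. 1 (Intro p. 4)] [cite: ReedSimon1972, Thm. VI.18, PDF p. 196] -/
theorem sum_re_soninTraceForm_le_of_hasSum_hilbertBasis (hg : Integrable g) {ι : Type*}
    (b : HilbertBasis ι ℂ (soninSpace 1 1)) {M : ℝ}
    (hM : HasSum (fun j => (soninTraceForm (weilConv g (weilReflect g))
      ((b j : soninSpace 1 1) : Lp ℂ 2 (volume : Measure ℝ))).re) M)
    {n : ℕ} (ξ : Fin n → Lp ℂ 2 (volume : Measure ℝ)) (hξ : Orthonormal ℂ ξ)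
    (hS : ∀ i, ξ i ∈ soninSpace 1 1) :
    ∑ i, (soninTraceForm (weilConv g (weilReflect g)) (ξ i)).re ≤ M := by
  rw [sum_re_soninTraceForm_autocorr_eq hg]
  simp_rw [re_soninTraceForm_autocorr hg] at hM
  exact sum_norm_sq_apply_le_of_hasSum b (ContinuousLinearMap.adjoint (scalingOp g)) hM hξ hS
    Finset.univ

/-- **The strong form does not depend on the orthonormal basis of `S(1,1)`**: if
`Σ_j Re⟨b_j | ϑ(g ∗ g*) b_j⟩ = M` for one Hilbert basis `(b_j)` of Sonin's space then the same holds for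
every Hilbert basis `(b'_j)` ("`Tr(ϑ(g)𝐒ϑ(g)*)`" is well defined; Reed–Simon I, Thm. VI.18).
[cite: ConnesConsani2021, Thm. 4.7 §4 p. 18] [cite: ReedSimon1972, Thm. VI.18, PDF p. 196] -/
theorem hasSum_re_soninTraceForm_hilbertBasis_of_hasSum (hg : Integrable g) {ι ι' : Type*}
    (b : HilbertBasis ι ℂ (soninSpace 1 1)) (b' : HilbertBasis ι' ℂ (soninSpace 1 1)) {M : ℝ}
    (hM : HasSum (fun j => (soninTraceForm (weilConv g (weilReflect g))
      ((b j : soninSpace 1 1) : Lp ℂ 2 (volume : Measure ℝ))).re) M) :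
    HasSum (fun j => (soninTraceForm (weilConv g (weilReflect g))
      ((b' j : soninSpace 1 1) : Lp ℂ 2 (volume : Measure ℝ))).re) M := by
  simp_rw [re_soninTraceForm_autocorr hg] at hM ⊢
  exact hasSum_norm_sq_apply_of_hasSum_of_mem b b' (ContinuousLinearMap.adjoint (scalingOp g)) hM


end Integrated

end Literature.NumberTheory.ConnesConsani2021

end
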